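import Summits.ResolutionOfSingularities.ResolutionOfSingularities.Theorems.JetCutMixed
import Mathlib
import HarnessLib

/-!
# JetCutDegenerate — decomp-res node «JetCut» (lens-2 g15 rev 5), file 1/2 of `JetCutDegenerate`

Content VERBATIM from the decomp-res lens-2 file `HOME/decomp-res-lens-2/g15/JetCut.lean` rev 5 (pin 9f53e5ca =
`parts/JetCut-rev5-9f53e5ca.lean`, 7 495 l;
HOME = run/shared/lean/pub/decomp-res; CRITIC-LEDGER rows 109 / 115 / 120 / 121 / 122 / 127 / 133 CLEARED; landing
order INBOX :231; the critic's
HYGIENE-landing.md h1–h11 applied — DOCSTRING-ONLY).  The lens's blocks RESTATED VERBATIM from lens-2 g12 / g13 /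
g14 (§R / §R13 / §R14) are DELETED:
they are the tree's `RelativeDeltaCut*` / `CurveLeafExit*` / `PinchCut*` modules (namespaces `RelativeDeltaCut`,
`CurveLeafExit`, `PinchCut`, opened;
the lens's `CurveLeafExitRestated.x` / `PinchCutRestated.x` are cited as `CurveLeafExit.x` / `PinchCut.x`, the three
pointwise engine edges of g12 as
`RelativeDeltaCut.x`).  Namespace `…Theorems.JetCut` (the lens's `Theses.JetCut` is gate-reserved), sub-namespaces
`Tame` / `Wide` / `Broad` / `Vast`
as in the lens; file split only (tree files ≤ 400 lines): sections, variables and every declaration exactly as in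
the lens, the long rev-0/1 prose
lives in HOME/decomp-res-lens-2/g15/NODE-g15.md §ARCHIVE-A (not in the tree).  Node files, in import order:
`JetCutJetKernels`, `JetCutPoint`, `JetCutClasses`, `JetCutKernels`, `JetCutTame`, `JetCutTameClasses`,
`JetCutTameKernels`, `JetCutLadder`, `JetCutWideClasses`, `JetCutWideKernels`, `JetCutMixed`, `JetCutBroadClasses`,
`JetCutBroadKernels`, `JetCutDegenerate`, `JetCutVastClasses`, `JetCutVastKernels`
(each possibly continued `…2`, `…3`), then the wiring `MaxContactCutJetCut*` (in the Theses cone).  All `--supports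
stmt-ResolutionOfSingularities-29273`
(`MaxContactCut.RungOne`); nothing closes 29273 — decided cells carry their engines as hypotheses, and exactly ONE
located-residual aside is booked on
the route for this column (`Vast.VastSpecialRung`, home `JetCutVastClasses`).

§N (rev 5): the DEGENERATE-VERTEX LADDER (D) — a DEPTH LAW for principal tails whose `W`-leader has a degenerate
vertex (`v^m·W^k`, `n ∤ k`): the degenerate kernels (`deg_chart_identity`, `deg_sidechart_identity`,
`deg_uchart_identity`, `deg_depth`, `deg_stop_degree`, `deg_no_cancel`, PROVED — next to `ladder_*` / `mixed_*`),
`section DegField` / `DegRing` shape lemmas, §N2 point level: `IsDegLadderAt`, uniformly shaped curves, ENGINE (D)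
`DegLadderExit` (HYGIENE h10), the VAST leaf (V) = (B) ∪ (D) with `VastExit`, the VAST-SPECIAL class
`IsVastSpecialPt` (bed visibly inhabited, HYGIENE h11) and the pointwise kernels.

Part 1/2 carries: `deg_chart_identity`, `deg_sidechart_identity`, `deg_uchart_identity`, `deg_depth`,
`deg_performed_order`, `deg_stop_degree`, `deg_no_cancel`, `deg_no_cancel_X₀`, `DegLadderShape`,
`degLadderShape_trinomial`, `ladderShape_of_degLadderShape_unit`, `degLadderShape_of_ladderShape_unit`,
`IsDegLadderAt`, `IsUniformDegLadderCurve`, `DegLadderExit`, `IsDegLadderCurvePt`.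

(Sources: HunekeSwanson2006 Cor. 5.5.5; CossartJannsenSaito2020 Ch. 2, Thm. 3.6/3.7, Ch. 8; CossartPiltant2008 Prop.
4.2; CossartPiltant2019 Rem. 3.2; Hironaka1964 Ch. III; Hironaka1967; Hironaka1977; Moh1987; Giraud1975.)
-/

open CategoryTheory AlgebraicGeometry TopologicalSpace IsLocalRing
open Literature.AlgebraicGeometry.Resolution
open Summit.ResolutionOfSingularities.ResolutionOfSingularities.Theorems
open Summit.ResolutionOfSingularities.ResolutionOfSingularities.Theorems.WeakOrderReduction
open Summit.ResolutionOfSingularities.ResolutionOfSingularities.Theorems.DeltaFaceCutClasses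
open Summit.ResolutionOfSingularities.ResolutionOfSingularities.Theorems.RelativeDeltaCut
open Summit.ResolutionOfSingularities.ResolutionOfSingularities.Theorems.CurveLeafExit
open Summit.ResolutionOfSingularities.ResolutionOfSingularities.Theorems.PinchCut

namespace Summit.ResolutionOfSingularities.ResolutionOfSingularities.Theorems.JetCut

section DegKernel

/-! ## §N  NEW (g15, rev 5): the DEGENERATE-VERTEX LADDER (D) — a DEPTH LAW for principal tails whose `W`-leader has a
NON-UNIT coefficient, a power `β^m` of the TRANSVERSAL parameter of the curve (`f = zⁿ + βUⁿ + β^m·ε·W^k + h`), with a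
THIRD exit mechanism (class ≥ 2 through the transversal variable `β̄`), and the VAST cut (V) = broad ∪ degenerate ladder.
Critic row 127 window: «with two fibre variables every UNIT-vertex leader is (L) or (L′)» — (D) is the first law of the
node for a vertex that is NOT a unit vertex, and it is where the purity jump of window item (i) lives INSIDE the cell
(see THE BRIDGE below).

THE CLASS (closed point `y′` of the top curve `C`, germ dimension 4, `I` PRINCIPAL at `y′`): regular parameters
`(z, U, W; v)`, `C = V(z, U, W)`, `I_{y′} = (f)` with `f = zⁿ + β·Uⁿ + β^m·ε·W^k + h`, `ε` a unit, `1 ≤ m`, `n ≤ k`,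
`n ∤ k`, `m + (k % n) ≤ n`, `h ∈ WtIdeal c n k (nk+1)` (rev 3's ONE-weight ideal VERBATIM: monomials `z^a U^b W^e` with
`(a + b)·k + e·n ≥ nk + 1`, weights `k, k, n` on `z, U, W`, weight `0` on the coefficient ring — `WtIdeal` is an ideal
of `𝒪_{y′}`, so `β`-multiples of admissible monomials are admissible), and the cone coefficient `β` a transversal
parameter (`(c, β) = 𝔪`: a CORE point) or a unit with `SideClean` (verbatim rev 3).  AT A UNIT-`β` POINT THE SHAPE IS
(L) BY LETTER with the unit leader `β^m·ε` (`ladderShape_of_degLadderShape_unit`, KERNEL; conversely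
`degLadderShape_of_ladderShape_unit` with `m = 1`): the new content sits at the core points of `C`, where the leader
`β^m ε W^k` is NOT on rev 3's face (its coefficient vanishes there) and `f` is in neither (L) nor (L′) by letter
(no unit pure `W`-power: every pure `W^e` in `h` has `e ≥ k + 1`; no unit mixed `U^aW^b` with `a < n` of low weight).
Bed (census ask T-deg-ladder, INBOX 18:12Z): `z² + v(u₁+u₂)² + v·u₁⁵` in characteristic 2 (`β = v`, `m = 1`, `k = 5`,
`ε = 1`, `h = 0`); `z³ + v(u₁+u₂)³ + v²·u₁⁴` (`m = 2`, `k = 4`), `z³ + v(u₁+u₂)³ + v·u₁⁴` / `+ v·u₁⁵` in characteristic 3;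
`z⁵ + v(u₁+u₂)⁵ + v²u₁⁸` in characteristic 5.  (In characteristic 2 no coordinate change makes `z² + vU² + vW⁵`
ladder- or mixed-ladder-shaped: `z ↦ z + g` creates only SQUARES `g²` — even pure `W`-powers, mixed monomials with even
`U`-exponent — and `U ↦ U + g(W)` creates only `v`-multiples.)

THE LAW (paper; EXACT-ON-PAPER, bookkeeping + exit PROVED in kernel; the performed stages are rev 3's VERBATIM).
`W`-chart of the blow-up of `C`: `f₁ = X₀ⁿ + βX₁ⁿ + β^m·ε·W^{k−n} + h₁` (`deg_chart_identity`; `h₁ ∈ WtIdeal c′ n (k−n)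
(n(k−n)+1)` by rev 3's `ladder_weight_step` BY NAME — the weights do not see the coefficient `β^m`): the SHAPE
REPRODUCES with `k ↦ k − n`, the same `β`, `ε`, `m`.  PERFORMED stages (`kᵢ ≥ n`, `ladder_depth` (i) BY NAME; since
`n ∤ k`, `kᵢ ≥ n + 1`, so the leader `β^m ε W^{kᵢ}` has order `m + kᵢ ≥ n + 2` — `deg_performed_order` — and is as
invisible as (L)'s `εW^{kᵢ}`): over a unit-`β` point everything is (L) (rev 3, re-walked in critic row 121); over a
core point the near locus in the fibre is the section point alone — at a fibre point with `X₀ ≠ 0` the value is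
`X₀ⁿ·(unit)` (every other term lies in `𝔪`: `β ∈ 𝔪`, and an `h`-monomial `z^aU^bW^e` becomes `X₀^aX₁^bW^{a+b+e−n}`,
a unit only if `a + b + e = n`, which admissibility `(a+b)kᵢ + e·n ≥ nkᵢ + 1` forbids when `kᵢ ≥ n`:
`(n − a − b)(n − kᵢ) ≥ 1` is impossible), at a fibre point with `X₀ = 0`, `X₁ ≠ 0` (rational or not: `X₁` a unit
there) the term `β·X₁ⁿ` carries the differential `dβ` of a regular parameter and nothing cancels it (a cancelling
`h`-term would again need `a + b + e = n`; `β^m ε W^{kᵢ₊₁} ∈ 𝔪²` as `kᵢ₊₁ ≥ 1`); the `U`-chart is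
`X₀′ⁿ + β·(1 + β^{m−1}·ε·U^{kᵢ−n}·X₂^{kᵢ}) + h/Uⁿ` (`deg_uchart_identity`, needs `1 ≤ m`): `β` times a UNIT plus terms
that are neither units nor `dβ`-carriers (`Uⁿ` is not admissible) — order `≤ 1` on the whole `U`-chart fibre over the
core point; the `z`-chart is `1 + βU′ⁿ + β^m ε·X₀^{kᵢ−n}W′^{kᵢ} + h/zⁿ` (`deg_sidechart_identity`) — a unit over the
core point (`zⁿ` is not admissible), of order `≤ 1` over unit-`β` points by `SideClean` exactly as in (L) (the extra
term is a multiple of `X₀`).  So the section curve `Cᵢ ≅ C` (= the order-`n` locus of the transform over `C`, an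
intrinsic closed subscheme — which is why the local `W`-origins glue) is regular, inside the top locus of the
principal transform (`f ∈ (X₀, X₁, W)ⁿ` by the degree bound `ladder_weight_step` (i)), weakly admissible (no snc
clause in `WeakAdmissible`); the generic point of `Cᵢ` is handled by the (L) computation over `k(η)` (`β` a unit in
`𝒪_{Cᵢ,η}`), no generic-point theorem.  After `i₀ = ⌊k/n⌋` blow-ups the STOP stage, `W`-exponent `k′ = k % n ∈
[1, n − 1]` (`deg_depth`, KERNEL): over unit-`β` points and at the generic point of `C_{i₀}` the order is `k′ < n`
((L)'s order exit); at a core point `x′ = y_{i₀}`: `f_{i₀} = X₀ⁿ + βX₁ⁿ + β^m ε W^{k′} + h_{i₀}` with every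
`h_{i₀}`-monomial of degree `≥ k′ + 1` in `(X₀, X₁, W)` (`deg_stop_degree`, KERNEL) — EITHER `m + k′ < n`: the leader
has order `m + k′ < n` and its initial monomial `β̄^m W̄^{k′}` is cancelled by no `h`-term (an `h`-generator
contributing to it would divide `W^{k′}`, and `W^j`, `j ≤ k′`, is never admissible: `deg_no_cancel`, KERNEL), so
`ord_{x′} f_{i₀} < n` (if an `h`-term has even smaller order, all the more): ORDER EXIT; OR `m + k′ = n` (`deg_depth`
dichotomy): either some `h`-term has order `< n` (order exit again) or `ord f_{i₀} = n` (`X̄₀ⁿ` is cancelled by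
nothing: `X₀^a`, `a ≤ n`, is not admissible) and the initial form is
`N = X̄₀ⁿ + ε̄·β̄^m W̄^{k′} + Q̄ ∈ κ(x′)[X̄₀, X̄₁, W̄, β̄]` (`β̄X̄₁ⁿ` has degree `n + 1`; `Q̄` = initial terms of `h_{i₀}`,
each a multiple of a non-constant monomial in `X̄₀, X̄₁, W̄`): `N` INVOLVES the transversal variable `β̄` (`m ≥ 1`, no
cancellation) and VANISHES at the `β̄`-coordinate point (no pure `β̄ⁿ`: the leader has `k′ ≥ 1`, `Q̄`'s monomials
contain a curve variable, `X̄₀ⁿ` does) — hence `N ≠ c·ℓⁿ` for every scalar `c`, linear form `ℓ`: rev 4's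
**`not_purePower_of_fibre` BY NAME with `i₂ = β̄`** (KERNEL, any field — so for the port's `τ` over `κ(x′)` (Hironaka's
directrix of the initial form over the residue field) and equally over `κ̄`), i.e. `τ(x′) ≥ 2`: CLASS EXIT, the port's
second exit condition (`PackageExitsOver`: order `< n` OR `τ ≥ 2`).  The other points of the last fibre over the core
point are off `V(f)` or of order `1` by the PERFORMED-stage analysis of stage `i₀ − 1` (`k_{i₀−1} = k′ + n ≥ n + 1`);
non-closed points by semicontinuity of order.  Hence ENGINE (D) `DegLadderExit` on paper for every regular `Y`, residue
field, characteristic: DECIDED-MOD-PORT (port L + HS 5.5.5 chart regularity + semicontinuity of order, as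
(J)/(T)/(L)/(L′)).  DEPTH `⌊k/n⌋` UNIFORMLY along `C` (core and unit points alike); predicted census signature: one
`τ = 1` near point `zⁿ` per performed stage, then at depth `⌊k/n⌋` NO near point (`m + k′ < n`) or ONE near point with
the stop form `X̄₀ⁿ + v̄^m·W̄^{k′}` INVOLVING `v̄` — the transversal parameter, absent from every stop form of (L′)
(`X̄₀ⁿ + Ū^aW̄^b`) — and nothing after it; CENSUS T-deg-ladder (HOME/census/tame/T-deg-ladder.md, sha256 de4d41cd…,
2026-08-30T18:19Z): 18/18 tail-free rows EXACTLY so (Top dimension 1 everywhere; class stops carry one `τ = 3` near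
point `zⁿ + v^m·u₁^{k′}`, order stops none), bridge row ✓.  CAVEAT (census (a), built into the dichotomy above): an
admissible UNIT pure power `W^{k″}` with `k″ < k + m` reaches degree `< n` at the stop stage and turns a class stop
into an ORDER exit at the same depth (`z³ + vU³ + v²u₁⁷ + u₁⁸`: no near point at depth 2) — an exit either way, which
is all `DegLadderExit` asserts; `z·W^k`-type tails are inert (3/3).  The typed law is «exit at depth `⌊k/n⌋`», not the
stop form.

THREE EXITS, THREE LAWS, ONE LADDER: (L) unit pure leader — order exit; (L′) unit mixed leader — class exit through the
FIBRE variable `W̄`; (D) `β^m`-leader — order exit through the bare `β^m` or class exit through the TRANSVERSAL variable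
`β̄`.  (D) is not a re-weighting / re-lettering of (L) or (L′): the weights ARE rev 3's, the leader is off their face at
the core point, and the exit variable is new; the shapes are disjoint at core points by letter (P-probes: (D) ⇏ (L),
(D) ⇏ (L′), (L′) ⇏ (D); and (L) ⊆ (D) exactly at unit-`β` points, KERNEL both ways).

THE BRIDGE TO THE PURITY JUMP (critic window (i) «`n ∣ k`, `τ` stays 1»; paper + census ask, NOT part of the typed class):
in the cell, a unit leader `εW^k` with `n = p ∣ k` and `ε̄ ∈ κᵖ` is ABSORBED — `ε = sᵖ + ε₁`, `ε₁ ∈ 𝔪_{y′}`,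
`z ↦ z + s·W^{k/p}` (characteristic `p`: `(z + sW^{k/p})ᵖ = zᵖ + sᵖW^k`, kernel bed `(z + W²)³ = z³ + W⁶` over `𝔽₃`)
— leaving `ε₁W^k = (ε_β·β + ε_W·W + ε_z·z + ε_U·U)·W^k`: the `z`/`U`-parts are admissible, `ε_W W^{k+1}` is a unit
leader with `n ∤ k + 1` (rev 3), and `ε_β·β·W^k` IS THE DEGENERATE VERTEX `m = 1` with `n ∣ k`.  When the absorbed
vertex has `n ∤ k` it is (D) as typed; when `n ∣ k` the SAME ladder runs `k/n` performed stages at the core point and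
ends by ORDER `m < n` through the bare `β^m·ε` (no purity question arises: the coefficient is a parameter, not a unit)
— bed `g = z³ + v(u₁+u₂)³ + (1 + v²)·u₁⁶ + u₁^10` over `𝔽₃`: by letter a unit leader with `3 ∣ 6` whose first near
point has `in = (X₀ + W)³`, `τ = 1` STAYS; absorbed: `z′³ + vU³ + v²u₁⁶ + u₁^10`, `m = 2 < 3`, predicted depth 2 with
an order-2 exit; by contrast `ε = 1` (`z³ + vU³ + u₁⁶`) leaves the cell (Top of dimension 2, census T-tame §3 (2):
11/11 unit-leader `n ∣ k` rows do).  The uniform statement for `n ∣ k` (unit-`β` points re-absorb to a degenerate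
vertex again — computed for `g` in NODE-g15.md §REV 5 — in general a `(β, W)`-polygon preparation) is the typed NEXT
target (D⁺) of NEXT-g16.md; (D) as typed keeps `n ∤ k`.
[cite: Hironaka1964 Ch. III §3 (directrix, τ); CossartJannsenSaito2020 Ch. 2; CossartPiltant2008 Prop. 4.2; Moh1987 /
Hauser2010 (purity jump = «kangaroo» phenomenon, for orientation only); folklore (quasi-homogeneous blow-up bookkeeping)] -/

/-- **DEGENERATE W-CHART IDENTITY** [rev 5; KERNEL (PROVED)]: under the blow-up of the section curve the degenerate
leader keeps its coefficient `β^m ε` and loses `n` in the exponent of `W` — the shape reproduces with `k ↦ k − n`.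
[folklore] -/
theorem deg_chart_identity {R : Type} [CommRing R] (β ε W X₀ X₁ : R) (m : ℕ) {n k : ℕ} (hnk : n ≤ k) :
    (W * X₀) ^ n + β * (W * X₁) ^ n + β ^ m * ε * W ^ k =
      W ^ n * (X₀ ^ n + β * X₁ ^ n + β ^ m * ε * W ^ (k - n)) := by
  obtain ⟨d, rfl⟩ := Nat.exists_eq_add_of_le hnk
  rw [Nat.add_sub_cancel_left, pow_add]
  ring

/-- **DEGENERATE z-CHART IDENTITY** [rev 5; KERNEL (PROVED)]: `1 + βU′ⁿ + (multiple of X₀^{k−n})` — a unit over a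
core point, order `≤ 1` over unit-`β` points by `SideClean`, exactly as in (L). [folklore] -/
theorem deg_sidechart_identity {R : Type} [CommRing R] (β ε X₀ U' W' : R) (m : ℕ) {n k : ℕ} (hnk : n ≤ k) :
    X₀ ^ n + β * (X₀ * U') ^ n + β ^ m * ε * (X₀ * W') ^ k =
      X₀ ^ n * (1 + β * U' ^ n + β ^ m * ε * (X₀ ^ (k - n) * W' ^ k)) := by
  obtain ⟨d, rfl⟩ := Nat.exists_eq_add_of_le hnk
  rw [Nat.add_sub_cancel_left, pow_add, mul_pow]
  ring

/-- **DEGENERATE U-CHART IDENTITY** [rev 5; KERNEL (PROVED)]: `X₀′ⁿ + β·(1 + β^{m−1}·ε·U^{k−n}·X₂^k)` — `β` times a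
UNIT over a core point (order `1` along the whole `U`-chart fibre: no near point at infinity); needs `1 ≤ m`.
[folklore] -/
theorem deg_uchart_identity {R : Type} [CommRing R] (β ε U X₀' X₂ : R) {m n k : ℕ} (hm : 1 ≤ m) (hnk : n ≤ k) :
    (U * X₀') ^ n + β * U ^ n + β ^ m * ε * (U * X₂) ^ k =
      U ^ n * (X₀' ^ n + β * (1 + β ^ (m - 1) * ε * (U ^ (k - n) * X₂ ^ k))) := by
  obtain ⟨d, rfl⟩ := Nat.exists_eq_add_of_le hnk
  obtain ⟨m', rfl⟩ := Nat.exists_eq_add_of_le hm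
  rw [Nat.add_sub_cancel_left, Nat.add_sub_cancel_left, pow_add, pow_add, mul_pow, pow_one]
  ring

/-- **DEGENERATE DEPTH** [rev 5; KERNEL (PROVED), from rev 3's `ladder_depth` BY NAME]: performed stages `i < ⌊k/n⌋`
(`kᵢ = k − i·n ≥ n`: the section curve lies in the top locus), stop exponent `k′ = k % n ≥ 1`, `m + 1 ≤ n`, and the
STOP DICHOTOMY `m + k′ < n` (order exit through the leader) or `m + k′ = n` (class exit through `β̄`). [folklore] -/
theorem deg_depth {n m k : ℕ} (hn : 1 ≤ n) (hndvd : ¬ n ∣ k) (hmk : m + k % n ≤ n) :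
    (∀ i, i < k / n → n ≤ k - i * n) ∧ 1 ≤ k % n ∧ k - (k / n) * n = k % n ∧ m + 1 ≤ n ∧
      (m + k % n < n ∨ m + k % n = n) := by
  obtain ⟨h1, h2, _, h4⟩ := ladder_depth hn hndvd
  exact ⟨h1, h2, h4, by omega, by omega⟩

/-- **PERFORMED-STAGE ORDER of the leader** [rev 5; KERNEL (PROVED)]: at a performed stage (`kᵢ ≥ n`, hence
`kᵢ ≥ n + 1` as `n ∤ k`) the leader `β^m ε W^{kᵢ}` has order `m + kᵢ ≥ n + 1` over a core point — it never enters the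
initial form `X̄₀ⁿ` (class 1, near point = section point, exactly as in (L)). [folklore] -/
theorem deg_performed_order {n m kᵢ : ℕ} (hm : 1 ≤ m) (hk : n ≤ kᵢ) : n + 1 ≤ m + kᵢ := by
  omega

/-- **STOP-STAGE DEGREE BOUND** [rev 5; KERNEL (PROVED)]: at the stop stage (`W`-exponent `k′ < n`) an admissible tail
monomial `z^a U^b W^e` (`(a + b)·k′ + e·n ≥ n·k′ + 1`) has degree `≥ k′ + 1`. [folklore] -/
theorem deg_stop_degree {n k' a b e : ℕ} (hk'n : k' < n) (hw : n * k' + 1 ≤ (a + b) * k' + e * n) :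
    k' + 1 ≤ a + b + e := by
  by_contra hlt
  have hle : a + b + e ≤ k' := by omega
  have h1 : (a + b) * k' ≤ (a + b) * n := Nat.mul_le_mul_left _ hk'n.le
  have h2 : (a + b) * n + e * n = (a + b + e) * n := by ring
  have h3 : (a + b + e) * n ≤ k' * n := Nat.mul_le_mul_right _ hle
  nlinarith

/-- **NO CANCELLATION of the degenerate leader** [rev 5; KERNEL (PROVED)]: a pure power `W^j` with `j ≤ k′` is never
admissible (`j·n < n·k′ + 1`) — so no tail term contributes the monomial `β̄^m·W̄^{k′}` of the initial form (tail
generators are monomials in `z, U, W`; a contribution would need a generator dividing `W^{k′}`); likewise `X₀^a`,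
`a ≤ n`, is not admissible at the stop stage (`a·k′ ≤ n·k′`), so `X̄₀ⁿ` survives, and no term at all is a pure `β̄ⁿ`
(every generator lies in `(z, U, W)`): the initial form involves `β̄` and vanishes at the `β̄`-point. [folklore] -/
theorem deg_no_cancel {n k' j : ℕ} (hj : j ≤ k') : ¬ n * k' + 1 ≤ (0 + 0) * k' + j * n := by
  intro h
  have h1 : j * n ≤ k' * n := Nat.mul_le_mul_right _ hj
  rw [zero_add, zero_mul, zero_add] at h
  nlinarith

/-- `deg_no_cancel_X₀`: Auxiliary step of this node's calculus, VERBATIM from the lens file (see the module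
docstring); the statement is its type. [folklore] -/
theorem deg_no_cancel_X₀ {n k' a : ℕ} (ha : a ≤ n) : ¬ n * k' + 1 ≤ (a + 0) * k' + 0 * n := by
  intro h
  have h1 : a * k' ≤ n * k' := Nat.mul_le_mul_right _ ha
  rw [add_zero, zero_mul, add_zero] at h
  omega

/-- Bed arithmetic of the census ask T-deg-ladder (INBOX 2026-08-30T18:12Z): `(p, n) = (2, 2)`, `k = 5`, `m = 1`: depth
`2`, `m + k % n = 2 = n` (class exit); `(3, 3)`: `k = 4`, `m = 1`: depth `1`, `1 + 1 < 3` (order exit); `k = 5`,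
`m = 1`: `1 + 2 = 3` (class); `k = 4`, `m = 2`: `2 + 1 = 3` (class); `k = 7`, `m = 2`: depth 2, class; `(5, 5)`:
`k = 8`, `m = 2`: depth 1, `2 + 3 = 5` (class); `k = 7`, `m = 1`: `1 + 2 < 5` (order).  KERNEL (`decide`). -/
example : 5 / 2 = 2 ∧ 1 + 5 % 2 = 2 ∧ 4 / 3 = 1 ∧ 1 + 4 % 3 < 3 ∧ 1 + 5 % 3 = 3 ∧ 2 + 4 % 3 = 3 ∧ 7 / 3 = 2 ∧
    2 + 7 % 3 = 3 ∧ 8 / 5 = 1 ∧ 2 + 8 % 5 = 5 ∧ 1 + 7 % 5 < 5 := by decide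

/-- THE BRIDGE (critic window (i)), characteristic 3: the absorption `z ↦ z + W²` of the unit leader of
`z³ + vU³ + (1 + v²)W⁶` is the identity `(z + W²)³ = z³ + W⁶`, leaving the DEGENERATE leader `v²W⁶` (`m = 2`,
`n ∣ k`: the core point then ends by ORDER 2 through the bare `v²` after `k/n = 2` blow-ups; typed next target (D⁺)).
KERNEL (PROVED, `add_pow_char`). -/
example (z W : MvPolynomial (Fin 2) (ZMod 3)) : (z + W ^ 2) ^ 3 = z ^ 3 + W ^ 6 := by
  haveI : Fact (Nat.Prime 3) := ⟨by norm_num⟩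
  rw [add_pow_char, ← pow_mul]

end DegKernel

section DegField

/-- Bed instance of the CLASS EXIT THROUGH THE TRANSVERSAL VARIABLE (`z² + v(u₁+u₂)² + v·u₁⁵`, characteristic 2, stop
stage 2: initial form `X̄₀² + v̄·W̄`; variables `X₀ ↦ 0, X₁ ↦ 1, W ↦ 2, v ↦ 3`): it involves `v̄` and vanishes at the
`v̄`-point, so it is no `c·ℓⁿ` — `τ ≥ 2` at the last near point (rev 4's `not_purePower_of_fibre` with `i₂ = 3 = v̄`).
KERNEL (PROVED). -/
example : ¬ ∃ (c : ZMod 2) (l : Fin 4 → ZMod 2) (n : ℕ),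
    (MvPolynomial.X 0 ^ 2 + MvPolynomial.X 3 * MvPolynomial.X 2 : MvPolynomial (Fin 4) (ZMod 2)) =
      MvPolynomial.C c * (∑ i, MvPolynomial.C (l i) * MvPolynomial.X i) ^ n := by
  haveI : Fact (Nat.Prime 2) := ⟨by norm_num⟩
  refine not_purePower_of_fibre 3 ?_ (by simp [MvPolynomial.eval_X])
  intro h
  have hv := MvPolynomial.mem_supported.1 h
  have key := MvPolynomial.eval₂Hom_congr' (f₁ := RingHom.id (ZMod 2)) (f₂ := RingHom.id (ZMod 2))
      (g₁ := fun i : Fin 4 => if i = 3 ∨ i = 2 then (1 : ZMod 2) else 0)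
      (g₂ := fun i : Fin 4 => if i = 2 then (1 : ZMod 2) else 0)
      (p₁ := (MvPolynomial.X 0 ^ 2 + MvPolynomial.X 3 * MvPolynomial.X 2 : MvPolynomial (Fin 4) (ZMod 2)))
      rfl ?_ rfl
  · simp at key
  · intro i hi _
    have hi' : i ∈ (({3}ᶜ : Set (Fin 4))) := hv hi
    fin_cases i <;> simp at hi' ⊢

/-- The class exit is ROBUST against a unit `Wⁿ` in the tail at the stop stage (`W^{k′+1} = Wⁿ` is admissible when
`k′ = n − 1`): `X̄₀² + v̄W̄ + W̄²` over `𝔽₂` still involves `v̄` and vanishes at the `v̄`-point.  KERNEL (PROVED). -/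
example : ¬ ∃ (c : ZMod 2) (l : Fin 4 → ZMod 2) (n : ℕ),
    (MvPolynomial.X 0 ^ 2 + MvPolynomial.X 3 * MvPolynomial.X 2 + MvPolynomial.X 2 ^ 2 :
        MvPolynomial (Fin 4) (ZMod 2)) =
      MvPolynomial.C c * (∑ i, MvPolynomial.C (l i) * MvPolynomial.X i) ^ n := by
  haveI : Fact (Nat.Prime 2) := ⟨by norm_num⟩
  refine not_purePower_of_fibre 3 ?_ (by simp [MvPolynomial.eval_X])
  intro h
  have hv := MvPolynomial.mem_supported.1 h
  have key := MvPolynomial.eval₂Hom_congr' (f₁ := RingHom.id (ZMod 2)) (f₂ := RingHom.id (ZMod 2))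
      (g₁ := fun i : Fin 4 => if i = 3 ∨ i = 2 then (1 : ZMod 2) else 0)
      (g₂ := fun i : Fin 4 => if i = 2 then (1 : ZMod 2) else 0)
      (p₁ := (MvPolynomial.X 0 ^ 2 + MvPolynomial.X 3 * MvPolynomial.X 2 + MvPolynomial.X 2 ^ 2 :
        MvPolynomial (Fin 4) (ZMod 2)))
      rfl ?_ rfl
  · simp at key
  · intro i hi _
    have hi' : i ∈ (({3}ᶜ : Set (Fin 4))) := hv hi
    fin_cases i <;> simp at hi' ⊢

/-- Characteristic 3, `m = 2`: the stop form `X̄₀³ + v̄²·W̄` of `z³ + v(u₁+u₂)³ + v²·u₁⁴` is no `c·ℓⁿ`.  KERNEL (PROVED). -/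
example : ¬ ∃ (c : ZMod 3) (l : Fin 4 → ZMod 3) (n : ℕ),
    (MvPolynomial.X 0 ^ 3 + MvPolynomial.X 3 ^ 2 * MvPolynomial.X 2 : MvPolynomial (Fin 4) (ZMod 3)) =
      MvPolynomial.C c * (∑ i, MvPolynomial.C (l i) * MvPolynomial.X i) ^ n := by
  haveI : Fact (Nat.Prime 3) := ⟨by norm_num⟩
  refine not_purePower_of_fibre 3 ?_ (by simp [MvPolynomial.eval_X])
  intro h
  have hv := MvPolynomial.mem_supported.1 h
  have key := MvPolynomial.eval₂Hom_congr' (f₁ := RingHom.id (ZMod 3)) (f₂ := RingHom.id (ZMod 3))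
      (g₁ := fun i : Fin 4 => if i = 3 ∨ i = 2 then (1 : ZMod 3) else 0)
      (g₂ := fun i : Fin 4 => if i = 2 then (1 : ZMod 3) else 0)
      (p₁ := (MvPolynomial.X 0 ^ 3 + MvPolynomial.X 3 ^ 2 * MvPolynomial.X 2 : MvPolynomial (Fin 4) (ZMod 3)))
      rfl ?_ rfl
  · simp at key
  · intro i hi _
    have hi' : i ∈ (({3}ᶜ : Set (Fin 4))) := hv hi
    fin_cases i <;> simp at hi' ⊢

end DegField

section DegRing

variable {R : Type} [CommRing R]

/-- **DEGENERATE-VERTEX SHAPE** `DegLadderShape M c β ε h f n m k` [rev 5; the one-step-reproducing presentation]: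
`f = c 0 ^ n + β * c 1 ^ n + β ^ m * ε * c 2 ^ k + h`, `ε` a unit, `h ∈ WtIdeal c n k (n*k+1)` (rev 3's ideal
VERBATIM), `n ≤ k`, `n ∤ k`, `1 ≤ m`, `m + k % n ≤ n`, the cone coefficient `β` a transversal parameter
(`span (c, β) = M`) or a unit, and rev 3's side condition.  EXACT-ON-PAPER consequence (§N docstring): principal
`I = (f)` of this shape uniformly along the regular top curve `V(c)` exits — by ORDER (`m + k % n < n`, or unit
points) or by CLASS ≥ 2 through `β̄` (`m + k % n = n` at a core point) — after `⌊k/n⌋` blow-ups of section curves.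
DEFINITION (NEW class predicate). [folklore; CossartJannsenSaito2020 Ch. 2] -/
def DegLadderShape (M : Ideal R) (c : Fin 3 → R) (β ε h f : R) (n m k : ℕ) : Prop :=
  f = c 0 ^ n + β * c 1 ^ n + β ^ m * ε * c 2 ^ k + h ∧ IsUnit ε ∧ h ∈ WtIdeal c n k (n * k + 1) ∧ n ≤ k ∧
    ¬ n ∣ k ∧ 1 ≤ m ∧ m + k % n ≤ n ∧ (Ideal.span (Set.range c ∪ {β}) = M ∨ IsUnit β) ∧ SideClean M c β n

/-- The model trinomial itself (`h = 0`) has degenerate-vertex shape whenever the side data are right.  KERNEL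
(PROVED). [folklore] -/
theorem degLadderShape_trinomial (M : Ideal R) (c : Fin 3 → R) (β ε : R) (n m k : ℕ) (hε : IsUnit ε)
    (hnk : n ≤ k) (hndvd : ¬ n ∣ k) (hm : 1 ≤ m) (hmk : m + k % n ≤ n)
    (hβ : Ideal.span (Set.range c ∪ {β}) = M ∨ IsUnit β) (hside : SideClean M c β n) :
    DegLadderShape M c β ε 0 (c 0 ^ n + β * c 1 ^ n + β ^ m * ε * c 2 ^ k) n m k :=
  ⟨by rw [add_zero], hε, Ideal.zero_mem _, hnk, hndvd, hm, hmk, hβ, hside⟩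

/-- **AT A UNIT-`β` POINT (D) IS (L) BY LETTER**: the leader coefficient `β^m ε` is a unit.  KERNEL (PROVED). [folklore] -/
theorem ladderShape_of_degLadderShape_unit {M : Ideal R} {c : Fin 3 → R} {β ε h f : R} {n m k : ℕ}
    (hβ : IsUnit β) (hD : DegLadderShape M c β ε h f n m k) : LadderShape M c β (β ^ m * ε) h f n k := by
  obtain ⟨hf, hε, hh, hnk, hndvd, _, _, hβM, hside⟩ := hD
  exact ⟨by rw [hf], (hβ.pow m).mul hε, hh, hnk, hndvd, hβM, hside⟩

/-- … and conversely a ladder shape with a unit cone coefficient is a degenerate-vertex shape with `m = 1`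
(`ε ↦ β⁻¹ε`).  KERNEL (PROVED). [folklore] -/
theorem degLadderShape_of_ladderShape_unit {M : Ideal R} {c : Fin 3 → R} {β ε h f : R} {n k : ℕ} (hn : 1 ≤ n)
    (hβ : IsUnit β) (hL : LadderShape M c β ε h f n k) :
    DegLadderShape M c β (↑(hβ.unit⁻¹) * ε) h f n 1 k := by
  obtain ⟨hf, hε, hh, hnk, hndvd, hβM, hside⟩ := hL
  have hmul : β ^ 1 * (↑(hβ.unit⁻¹) * ε) = ε := by
    rw [pow_one, ← mul_assoc, IsUnit.mul_val_inv, one_mul]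
  refine ⟨by rw [hmul]; exact hf, (Units.isUnit _).mul hε, hh, hnk, hndvd, le_rfl, ?_, hβM, hside⟩
  have := Nat.mod_lt k (show 0 < n by omega)
  omega

end DegRing

/-! ### §N2  point level — degenerate-vertex points, uniformly shaped curves, ENGINE (D), the VAST leaf and its residual -/

/-- **DEGENERATE-VERTEX-SHAPED at `y` transversal to `η` with exponents `(n, m, k)`** [rev 5] (`IsDegLadderAt I n m k η y`):
germ dimension 4, regular parameters `c = (z, U, W)` generating the curve prime, `(c, v) = 𝔪_y`, `I_y = (f)` PRINCIPAL,
`f` of degenerate-vertex shape.  DEFINITION (NEW class predicate). (Sources: CossartJannsenSaito2020 Ch. 2; folklore.) -/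
def IsDegLadderAt {Y : Scheme.{0}} (I : Y.IdealSheafData) (n m k : ℕ) (η y : Y) : Prop :=
  ∃ h : η ⤳ y, ∃ (c : Fin 3 → Y.presheaf.stalk y) (v β ε r f : Y.presheaf.stalk y),
    Ideal.span (Set.range c) = curvePrime h ∧
      Ideal.span (Set.range c ∪ {v}) = maximalIdeal (Y.presheaf.stalk y) ∧
      (maximalIdeal (Y.presheaf.stalk y)).spanFinrank = 4 ∧
      stalkIdeal I y = Ideal.span {f} ∧
      DegLadderShape (maximalIdeal (Y.presheaf.stalk y)) c β ε r f n m k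

/-- **UNIFORMLY DEGENERATE-VERTEX-SHAPED CURVE** [rev 5] (`IsUniformDegLadderCurve I n m k η`): `η` is a curve point and
EVERY closed point of `closure {η}` is degenerate-vertex-shaped transversal to `η` with the SAME exponents `(n, m, k)`
(at the unit-`β` points this is rev 3's ladder shape by letter).  The hypothesis of ENGINE (D).  DEFINITION (NEW class
predicate). -/
def IsUniformDegLadderCurve {Y : Scheme.{0}} (I : Y.IdealSheafData) (n m k : ℕ) (η : Y) : Prop :=
  IsCurvePt η ∧ ∀ y : Y, η ⤳ y → IsClosed ({y} : Set Y) → IsDegLadderAt I n m k η y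

/-- **ENGINE (D) `DegLadderExit`** [rev 5; DECIDED · paper proof = the degenerate-vertex ladder of the §N docstring:
`⌊k/n⌋` blow-ups of section curves, shape reproduction by `deg_chart_identity` + rev 3's `ladder_weight_step` (KERNEL),
side charts by `deg_sidechart_identity` / `deg_uchart_identity` (KERNEL) + `SideClean`, stop stage by `deg_depth` /
`deg_stop_degree` / `deg_no_cancel` (KERNEL), exit by ORDER (`m + k % n < n`, unit points) or by CLASS through `β̄`
(`not_purePower_of_fibre`, KERNEL) — the law ASSERTS THE EXIT at depth `⌊k/n⌋` (order `< n` or `τ ≥ 2` at every point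
of the last fibre), NOT the stop KIND: predicted census signature = class stop `zⁿ + v^m·u₁^{k % n}` UNLESS an admissible
unit pure power `W^{k″}` with `k″ < k + m` undercuts it, in which case the same stage ends by order (census T-deg-ladder
caveat (a): 2/3 such rows); if the stop FORM is wanted as a theorem, raise the pure-`W` threshold of the tail ideal to
weight `≥ n(k + m)` (HYGIENE h10); ingredients of the port: HS 5.5.5 regularity of the chart rings, permissibility of
regular centres in the top locus of a principal marked ideal, semicontinuity of order — commutative algebra over the
regular local rings `𝒪_{Y,y′}` and `𝒪_{Y,η}`; no generic-point theorem · every regular scheme, residue field,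
characteristic]: a uniformly degenerate-vertex-shaped curve of order `n ≥ 2` has an exit package with centres over it.
STATEMENT (engine). (Sources: Hironaka1964; CossartJannsenSaito2020 Ch. 2, Ch. 8; CossartPiltant2008 Prop. 4.2.) -/
def DegLadderExit : Prop :=
  ∀ (Y : Scheme.{0}), Scheme.IsRegular Y → ∀ (I : Y.IdealSheafData) (n : ℕ), 2 ≤ n → ∀ (m k : ℕ) (η : Y),
    IsUniformDegLadderCurve I n m k η → PackageExitsOver I n {y : Y | η ⤳ y}

/-- **DEGENERATE-LADDER-CURVE point** [rev 5] (NEW DECIDED CLASS, leaf (D)): `y` lies on (or is the generic point of) a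
Top-isolated, uniformly degenerate-vertex-shaped curve.  DEFINITION (NEW class). -/
def IsDegLadderCurvePt {Y : Scheme.{0}} (I : Y.IdealSheafData) (n : ℕ) (y : Y) : Prop :=
  ∃ (η : Y) (m k : ℕ), η ⤳ y ∧ IsTopIsolatedClosure I n η ∧ IsUniformDegLadderCurve I n m k η

end Summit.ResolutionOfSingularities.ResolutionOfSingularities.Theorems.JetCut
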